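import Mathlib
import Literature.Barriers.ValiantsHypothesis.AlgebraicNaturalProofs
import Summits.ValiantsHypothesis.ValiantsHypothesis.Theorems.BarrierLeverSuccinctHittingSetsForVPLowPartials
import Summits.ValiantsHypothesis.ValiantsHypothesis.Theorems.BarrierLeverDefinableEquationsSparsityWallTwoSupport
import HarnessLib

/-!
# Crux `BarrierLever.SuccinctHittingSetsForVP` (stmt-ValiantsHypothesis-14610) — DISTINGUISHERS WITH
# `poly(N)` MANY PARTIAL DERIVATIVES (in particular `ΣΛΣ`) ARE HIT ALREADY BY `SmallCircuits ℂ n 2`;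
# the partials of a natural proof against size `n²` span `> N^a` dimensions (val-np-p5 g16)

`…LowPartials.lean` (wave 3 of the 14610 line; Nisan–Wigderson's partial-derivative measure applied
to the DISTINGUISHER): a nonzero `D` whose partials span `< 2^{t+1}` dimensions has a monomial on
`≤ t` coordinates (inclusion-minimal support, `stub_derivDimension`), hence is hit by a `t`-sparse
member of the class once `t(2n+2) ≤ n^b` — exponent `b = 3`, and dually `dim ∂^*(D) > 2^{n^{b-2}}`
for an equation at `b ≥ 2` (nothing at `b = 2`).  With the AMORTISED cost of `t·n` free monomials
(`SparsityWall.mul_lt_card_support_monomial_two`, `…SparsityWallTwoSupport.lean`: every monomial of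
an equation for `SmallCircuits ℂ n b`, `b ≥ 2`, touches `> t·n` coordinates, for every `t`,
eventually in `n`) the row moves to the open rung:

* `pow_lt_finrank_partials_two` — for every `a`, eventually in `n`, for every `b ≥ 2`: the partial
  derivatives of a nonzero `D` vanishing on `coeff(SmallCircuits ℂ n b)` span MORE than `C(2n,n)^a`
  dimensions (`two_pow_mul_lt_finrank_partials_two`: more than `2^{t·n}`, every `t`);
* `isSuccinctHittingSet_lowPartials_two` — `SmallCircuits ℂ n b`, `b ≥ 2`, hits every nonzero `D`
  with partials in a space of dimension `≤ N^a` (tree: `b = 3`, `isSuccinctHittingSet_lowPartials`);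
* `isSuccinctHittingSet_sigmaLambdaSigma_two` — in particular every nonzero `ΣΛΣ` (Waring-type,
  diagonal depth-3) distinguisher of polynomial size is hit at `b = 2` (tree: `b = 3`);
* `pow_lt_finrank_partials_of_isNaturalProof_two`, `pow_lt_finrank_partials_boolSum_two` — FSV /
  crux currency: a natural proof against size `n²` (any `𝒟`), in particular every Boolean-sum
  witness of `DefinableEquations` / `SingleSizeEquations` at `(n, 2)`, has partial-derivative
  dimension `> N^a` for every `a` — the proof itself is hard for Nisan–Wigderson's measure.

WHAT THIS IS NOT: nothing on the dense case of the crux or on `VP ≠ VNP`; `b = 2` stays OPEN for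
8745/8749.  No definitions, no named facts; standard axioms.  Refs: [ForbesShpilkaVolk2018] Def. 1,
Thm. 9; Nisan–Wigderson 1996 (the measure); Bürgisser 2000 Rem. 2.7.
-/

-- layout Summits/ValiantsHypothesis/ValiantsHypothesis forces the duplicated namespace component
set_option linter.dupNamespace false

namespace Summit.ValiantsHypothesis.ValiantsHypothesis.Theorems.BarrierLever.SuccinctHittingSetsForVP

open Literature.Barriers.ValiantsHypothesis Literature.Computability.AlgebraicComplexity MvPolynomial
open Summit.ValiantsHypothesis.ValiantsHypothesis.Theorems.BarrierLeverDefinableEquations.SparsityWall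
  (mul_lt_card_support_monomial_two choose_pow_lt_two_pow)

namespace LowPartials

/-- **The partials of an equation at the open rung span more than `2^{t·n}` dimensions**, for every
`t`, eventually in `n`, for every `b ≥ 2`: an inclusion-minimal monomial of the equation touches
`> t·n` coordinates (amortised support wall) and yields `2^{> t·n}` independent derivatives
(`stub_derivDimension`). [folklore] -/
theorem two_pow_mul_lt_finrank_partials_two :
    ∀ t : ℕ, ∃ n₀ : ℕ, ∀ n : ℕ, n₀ ≤ n → ∀ b : ℕ, 2 ≤ b →
      ∀ D : MvPolynomial (degLEMonomials n) ℂ, D ≠ 0 →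
        (∀ f ∈ SmallCircuits ℂ n b, eval (coeffVector (degLEMonomials n) f) D = 0) →
          ∀ V : Submodule ℂ (MvPolynomial (degLEMonomials n) ℂ), FiniteDimensional ℂ V →
            (∀ g, apolarAction g D ∈ V) → 2 ^ (t * n) < Module.finrank ℂ V := by
  classical
  intro t
  obtain ⟨n₀, h⟩ := mul_lt_card_support_monomial_two t
  refine ⟨n₀, fun n hn b hb D hD0 hvan V hVfd hVmem => ?_⟩
  obtain ⟨m, hm, hmin⟩ := LowPartialsHit.exists_support_minimal hD0
  have hwide : t * n < m.support.card := h n hn b hb D hvan m hm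
  have hdim : 2 ^ m.support.card ≤ Module.finrank ℂ V :=
    stub_derivDimension (degLEMonomials n) D m hm hmin V hVfd fun v _ => hVmem _
  exact lt_of_lt_of_le (Nat.pow_lt_pow_right (by norm_num) hwide) hdim

/-- **… hence more than `C(2n,n)^a` dimensions**, for every `a`, eventually in `n`, for every
`b ≥ 2` (`C(2n,n)^a < 2^{2an+1} ≤ 2^{(2a+1)n}`). [folklore] -/
theorem pow_lt_finrank_partials_two :
    ∀ a : ℕ, ∃ n₀ : ℕ, ∀ n : ℕ, n₀ ≤ n → ∀ b : ℕ, 2 ≤ b →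
      ∀ D : MvPolynomial (degLEMonomials n) ℂ, D ≠ 0 →
        (∀ f ∈ SmallCircuits ℂ n b, eval (coeffVector (degLEMonomials n) f) D = 0) →
          ∀ V : Submodule ℂ (MvPolynomial (degLEMonomials n) ℂ), FiniteDimensional ℂ V →
            (∀ g, apolarAction g D ∈ V) → Nat.choose (2 * n) n ^ a < Module.finrank ℂ V := by
  intro a
  obtain ⟨n₀, h⟩ := two_pow_mul_lt_finrank_partials_two (2 * a + 1)
  refine ⟨max n₀ 1, fun n hn b hb D hD0 hvan V hVfd hVmem => ?_⟩
  have hn1 : 1 ≤ n := le_trans (le_max_right _ _) hn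
  have hlt := h n (le_trans (le_max_left _ _) hn) b hb D hD0 hvan V hVfd hVmem
  calc Nat.choose (2 * n) n ^ a < 2 ^ (2 * a * n + 1) := choose_pow_lt_two_pow a n
    _ ≤ 2 ^ ((2 * a + 1) * n) := Nat.pow_le_pow_right (by norm_num) (by nlinarith)
    _ ≤ Module.finrank ℂ V := hlt.le

end LowPartials

open LowPartials

/-- **Distinguishers with polynomially many partial derivatives are hit at exponent 2.**  For every
`a` there is `n₀` such that for all `n ≥ n₀` and every `b ≥ 2`, the coefficient vectors of
`SmallCircuits ℂ n b` hit every nonzero polynomial in the `N = C(2n,n)` coefficient variables whose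
partial derivatives lie in a space of dimension `≤ N^a` (tree: `b = 3`). [folklore] -/
theorem isSuccinctHittingSet_lowPartials_two :
    ∀ a : ℕ, ∃ n₀ : ℕ, ∀ n : ℕ, n₀ ≤ n → ∀ b : ℕ, 2 ≤ b →
      IsSuccinctHittingSet (degLEMonomials n) (SmallCircuits ℂ n b)
        {D | ∃ V : Submodule ℂ (MvPolynomial (degLEMonomials n) ℂ), FiniteDimensional ℂ V ∧
          Module.finrank ℂ V ≤ Nat.choose (2 * n) n ^ a ∧ ∀ g, apolarAction g D ∈ V} := by
  intro a
  obtain ⟨n₀, h⟩ := pow_lt_finrank_partials_two a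
  refine ⟨n₀, fun n hn b hb => ?_⟩
  rintro D ⟨V, hVfd, hVdim, hVmem⟩ hD0
  by_contra hcon
  push Not at hcon
  exact absurd hVdim (not_le.mpr (h n hn b hb D hD0 hcon V hVfd hVmem))

/-- **`ΣΛΣ` distinguishers are hit at exponent 2.**  For every `a`, eventually in `n`, for every
`b ≥ 2`, `SmallCircuits ℂ n b` hits every nonzero sum of powers of affine forms in the coefficient
variables with `Σ_i (d_i + 1) ≤ N^a` — no diagonal depth-3 (Waring-type) circuit of polynomial size
is a natural proof against size-`n²` circuits (tree: `b = 3`). [folklore] -/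
theorem isSuccinctHittingSet_sigmaLambdaSigma_two :
    ∀ a : ℕ, ∃ n₀ : ℕ, ∀ n : ℕ, n₀ ≤ n → ∀ b : ℕ, 2 ≤ b →
      IsSuccinctHittingSet (degLEMonomials n) (SmallCircuits ℂ n b)
        {D | ∃ (s : ℕ) (A : Finset (degLEMonomials n)) (c ℓ₀ : Fin s → ℂ)
            (ℓ : Fin s → degLEMonomials n → ℂ) (d : Fin s → ℕ),
          ∑ i, (d i + 1) ≤ Nat.choose (2 * n) n ^ a ∧
          D = ∑ i : Fin s, C (c i) * (C (ℓ₀ i) + ∑ μ ∈ A, C (ℓ i μ) * X μ) ^ (d i)} := by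
  intro a
  obtain ⟨n₀, h⟩ := isSuccinctHittingSet_lowPartials_two a
  refine ⟨n₀, fun n hn b hb => (h n hn b hb).mono le_rfl ?_⟩
  rintro D ⟨s, A, c, ℓ₀, ℓ, d, hsum, rfl⟩
  obtain ⟨V, hVfd, hVdim, hVmem⟩ := stub_sigmaLambdaSigma (degLEMonomials n) s A c ℓ₀ ℓ d
  exact ⟨V, hVfd, hVdim.trans hsum, hVmem⟩

/-- **Natural proofs against size `n²` have super-polynomially many independent partials.**  For
every `a`, eventually in `n`, for every `b ≥ 2`: if `D` is an algebraically natural proof against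
`SmallCircuits ℂ n b` (FSV Def. 1, ANY distinguisher class `𝒟`) and its partial derivatives lie in a
finite-dimensional `V`, then `dim V > C(2n,n)^a` (tree: `> 2^{n^{b-2}}`, empty at `b = 2`).
[cite: ForbesShpilkaVolk2018, Def. 1] -/
theorem pow_lt_finrank_partials_of_isNaturalProof_two :
    ∀ a : ℕ, ∃ n₀ : ℕ, ∀ n : ℕ, n₀ ≤ n → ∀ b : ℕ, 2 ≤ b →
      ∀ (𝒟 : Set (MvPolynomial (degLEMonomials n) ℂ)) (D : MvPolynomial (degLEMonomials n) ℂ),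
        IsNaturalProof (degLEMonomials n) (SmallCircuits ℂ n b) 𝒟 D →
          ∀ V : Submodule ℂ (MvPolynomial (degLEMonomials n) ℂ), FiniteDimensional ℂ V →
            (∀ g, apolarAction g D ∈ V) → Nat.choose (2 * n) n ^ a < Module.finrank ℂ V := by
  intro a
  obtain ⟨n₀, h⟩ := pow_lt_finrank_partials_two a
  exact ⟨n₀, fun n hn b hb 𝒟 D hD V hVfd hVmem => h n hn b hb D hD.2.1 hD.2.2 V hVfd hVmem⟩

/-- **Crux currency: Boolean-sum witnesses at `(n, 2)` are hard for the partial-derivative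
measure.**  For every `a`, eventually in `n`: if `boolSum H ≠ 0` vanishes on
`coeff(SmallCircuits ℂ n 2)` (the data of `DefinableEquations` / `SingleSizeEquations` at the open
rung, any `q`, any size and degree of `H`) and its partials lie in a finite-dimensional `V`, then
`dim V > C(2n,n)^a`. [cite: ForbesShpilkaVolk2018, Def. 1] -/
theorem pow_lt_finrank_partials_boolSum_two :
    ∀ a : ℕ, ∃ n₀ : ℕ, ∀ n : ℕ, n₀ ≤ n → ∀ (q : ℕ)
      (H : MvPolynomial (↥(degLEMonomials n) ⊕ Fin q) ℂ), boolSum H ≠ 0 →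
        (∀ f ∈ SmallCircuits ℂ n 2, eval (coeffVector (degLEMonomials n) f) (boolSum H) = 0) →
          ∀ V : Submodule ℂ (MvPolynomial (degLEMonomials n) ℂ), FiniteDimensional ℂ V →
            (∀ g, apolarAction g (boolSum H) ∈ V) → Nat.choose (2 * n) n ^ a < Module.finrank ℂ V := by
  intro a
  obtain ⟨n₀, h⟩ := pow_lt_finrank_partials_two a
  exact ⟨n₀, fun n hn q H hne hvan V hVfd hVmem => h n hn 2 le_rfl (boolSum H) hne hvan V hVfd hVmem⟩

end Summit.ValiantsHypothesis.ValiantsHypothesis.Theorems.BarrierLever.SuccinctHittingSetsForVP
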